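import Mathlib.NumberTheory.Padics.Complex
import Literature.NumberTheory.IwasawaTheory.LayerIwasawaInvariants
import HarnessLib

/-!
# Stub A2 `stub_layerLambda_stable` of line `birth` for crux `ThetaLayerLambdaCongruenceAtTwo`
# (stmt-BirchSwinnertonDyer-20688, route ResidualThetaTransportAtTwo): stability of the layer
# `λ`-invariant under a non-zero rescaling and a perturbation strictly below the sup norm

Lead prover `bsd-wall-rtt-p3` g0 (LINE mode), `--supports stmt-BirchSwinnertonDyer-20688`; registered
stub `stub_layerLambda_stable` of the birth skeleton (planner bsd-wall-p2 g8/g9, sha16 of the registered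
file `ebcedd75615b74a2`; stub signatures inlined by the lead, composition unchanged).

THE STATEMENT (Pollack–Weston 2011 §3.1 vocabulary, tree file
`Literature/NumberTheory/IwasawaTheory/LayerIwasawaInvariants.lean`): for polynomials `θ, θ'` over `ℚ̄₂`
(`PadicAlgCl 2`) and a scalar `c ≠ 0`, if `‖θ - c·θ'‖_sup < ‖θ‖_sup` then `λ(θ) = λ(θ')`, where
`λ(θ) = layerLambda θ = min {j : ‖θ_j‖ = ‖θ‖_sup}` is the layer `λ`-invariant. PROOF (ultrametric, three
lines on paper): every coefficient satisfies `‖θ_j - c θ'_j‖ < ‖θ‖_sup`, so `‖θ_j‖ = ‖θ‖_sup` iff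
`‖c θ'_j‖ = ‖θ‖_sup`; taking `j` with `‖θ_j‖ = ‖θ‖_sup` gives `‖c‖·‖θ'‖_sup = ‖θ‖_sup`, whence the sets of
indices where the two sup norms are attained coincide and so do their minima. Everything here is proved;
no fact is cited; the lemma is pure normed algebra and holds over any ultrametric normed field (we prove
it in that generality and specialise to `PadicAlgCl 2` for the registered signature).

HONEST FRAMING: this is the small algebraic stub of the line; the load-bearing stub A1
(`stub_depletedLayerCongruence`, congruence of the `S₀`-depleted layer Mazur–Tate elements at `p = 2`) is
research mathematics and is NOT touched here. BSD is not proved by any of this.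

References: R. Pollack, T. Weston, Duke Math. J. 156 (2011), §3.1 [PollackWeston2011MT].
-/

noncomputable section

-- justification: the `Summit.BirchSwinnertonDyer.BirchSwinnertonDyer.…` path repeats a component (route-file convention)
set_option linter.dupNamespace false

open Polynomial

open Literature.NumberTheory.IwasawaTheory

namespace Summit.BirchSwinnertonDyer.BirchSwinnertonDyer.Theorems.ThetaLayerLambdaCongruenceAtTwo

/-! ### Ultrametric bookkeeping on single coefficients -/

section Ultrametric

variable {E : Type*} [SeminormedAddCommGroup E] [IsUltrametricDist E]

/-- In an ultrametric normed group: if `‖a - b‖ < ‖a‖` then `‖b‖ = ‖a‖` ("all triangles are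
isosceles"). [folklore] -/
theorem norm_eq_of_norm_sub_lt_norm {a b : E} (h : ‖a - b‖ < ‖a‖) : ‖b‖ = ‖a‖ := by
  apply le_antisymm
  · have h1 : ‖b‖ ≤ max ‖a‖ ‖b - a‖ := by
      simpa using IsUltrametricDist.norm_add_le_max a (b - a)
    rw [norm_sub_rev] at h1
    exact h1.trans (max_le le_rfl h.le)
  · by_contra hlt
    have hlt' : ‖b‖ < ‖a‖ := not_le.mp hlt
    have h2 : ‖a‖ ≤ max ‖a - b‖ ‖b‖ := by
      simpa using IsUltrametricDist.norm_add_le_max (a - b) b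
    have : max ‖a - b‖ ‖b‖ < ‖a‖ := max_lt h hlt'
    exact absurd h2 (not_le.mpr this)

/-- If `‖a - b‖ < N` and `‖a‖ < N` then `‖b‖ < N`. [folklore] -/
theorem norm_lt_of_norm_sub_lt_of_norm_lt {a b : E} {N : ℝ} (h : ‖a - b‖ < N) (ha : ‖a‖ < N) :
    ‖b‖ < N := by
  have h1 : ‖b‖ ≤ max ‖a‖ ‖b - a‖ := by
    simpa using IsUltrametricDist.norm_add_le_max a (b - a)
  rw [norm_sub_rev] at h1
  exact h1.trans_lt (max_lt ha h)

/-- If `‖a - b‖ < N` and `‖a‖ = N` then `‖b‖ = N`. [folklore] -/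
theorem norm_eq_of_norm_sub_lt_of_norm_eq {a b : E} {N : ℝ} (h : ‖a - b‖ < N) (ha : ‖a‖ = N) :
    ‖b‖ = N := by
  subst ha
  exact norm_eq_of_norm_sub_lt_norm h

end Ultrametric

/-! ### The sup norm of a rescaled polynomial and the stability of `λ` -/

section SupNorm

variable {K : Type*} [NormedField K]

/-- `‖(C c · θ)_j‖ = ‖c‖ · ‖θ_j‖`. [folklore] -/
theorem norm_coeff_C_mul (c : K) (θ : K[X]) (j : ℕ) : ‖(C c * θ).coeff j‖ = ‖c‖ * ‖θ.coeff j‖ := by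
  rw [coeff_C_mul, norm_mul]

/-- `‖C c · θ‖_sup = ‖c‖ · ‖θ‖_sup` over a normed field. [folklore] -/
theorem supNorm_C_mul (c : K) (θ : K[X]) : (C c * θ).supNorm = ‖c‖ * θ.supNorm := by
  apply le_antisymm
  · obtain ⟨i, hi⟩ := (C c * θ).exists_eq_supNorm
    rw [hi, norm_coeff_C_mul]
    exact mul_le_mul_of_nonneg_left (θ.le_supNorm i) (norm_nonneg c)
  · obtain ⟨i, hi⟩ := θ.exists_eq_supNorm
    rw [hi, ← norm_coeff_C_mul]
    exact (C c * θ).le_supNorm i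

variable [IsUltrametricDist K]

/-- **Stability of the layer `λ`-invariant** over any ultrametric normed field: if `c ≠ 0` and
`‖θ - C c · θ'‖_sup < ‖θ‖_sup` then `layerLambda θ = layerLambda θ'` (Pollack–Weston §3.1: `λ` only sees
the leading `p`-adic order). [cite: PollackWeston2011MT, §3.1] -/
theorem layerLambda_eq_of_supNorm_sub_C_mul_lt {θ θ' : K[X]} {c : K} (hc : c ≠ 0)
    (h : (θ - C c * θ').supNorm < θ.supNorm) : layerLambda θ = layerLambda θ' := by
  set N := θ.supNorm with hN
  -- every coefficient of the difference is `< N`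
  have hcoeff : ∀ j, ‖θ.coeff j - c * θ'.coeff j‖ < N := fun j ↦ by
    have := (θ - C c * θ').le_supNorm j
    rw [coeff_sub, coeff_C_mul] at this
    exact this.trans_lt h
  -- the rescaled polynomial has the same sup norm
  have hcpos : 0 < ‖c‖ := norm_pos_iff.mpr hc
  have hsup : ‖c‖ * θ'.supNorm = N := by
    rw [← supNorm_C_mul]
    apply le_antisymm
    · obtain ⟨i, hi⟩ := (C c * θ').exists_eq_supNorm
      rw [hi, coeff_C_mul]
      rcases eq_or_lt_of_le (θ.le_supNorm i) with heq | hlt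
      · exact (norm_eq_of_norm_sub_lt_of_norm_eq (hcoeff i) heq).le
      · exact (norm_lt_of_norm_sub_lt_of_norm_lt (hcoeff i) hlt).le
    · obtain ⟨i, hi⟩ := θ.exists_eq_supNorm
      have := norm_eq_of_norm_sub_lt_of_norm_eq (hcoeff i) hi.symm
      rw [← coeff_C_mul] at this
      rw [← this]
      exact (C c * θ').le_supNorm i
  -- characterise `λ(θ)` by `λ(θ')`
  rw [layerLambda_eq_iff]
  obtain ⟨hm, hlt⟩ := (layerLambda_eq_iff (θ := θ')).mp rfl
  refine ⟨?_, fun j hj ↦ ?_⟩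
  · -- the coefficient of `θ` at `λ(θ')` has norm `N`
    have h1 : ‖c * θ'.coeff (layerLambda θ')‖ = N := by
      rw [norm_mul, hm, hsup]
    have h2 : ‖c * θ'.coeff (layerLambda θ') - θ.coeff (layerLambda θ')‖ < N := by
      rw [norm_sub_rev]; exact hcoeff _
    exact norm_eq_of_norm_sub_lt_of_norm_eq h2 h1
  · -- before `λ(θ')` the coefficients of `θ` are `< N`
    have h1 : ‖c * θ'.coeff j‖ < N := by
      rw [norm_mul, ← hsup]
      exact mul_lt_mul_of_pos_left (hlt j hj) hcpos
    have h2 : ‖c * θ'.coeff j - θ.coeff j‖ < N := by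
      rw [norm_sub_rev]; exact hcoeff _
    exact norm_lt_of_norm_sub_lt_of_norm_lt h2 h1

end SupNorm

/-! ### The registered stub, verbatim -/

/-- **Stub A2 `stub_layerLambda_stable` of line `birth` (crux `ThetaLayerLambdaCongruenceAtTwo`,
stmt-BirchSwinnertonDyer-20688), VERBATIM the registered signature**: over `ℚ̄₂ = PadicAlgCl 2`, a
non-zero rescaling and a perturbation strictly below the sup norm do not change the layer `λ`-invariant
`layerLambda` (Pollack–Weston 2011 §3.1). Specialisation of
`layerLambda_eq_of_supNorm_sub_C_mul_lt`. [cite: PollackWeston2011MT, §3.1] -/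
theorem stub_layerLambda_stable : ∀ (θ θ' : Polynomial (PadicAlgCl 2)) (c : PadicAlgCl 2), c ≠ 0 → (θ - Polynomial.C c * θ').supNorm < θ.supNorm → Literature.NumberTheory.IwasawaTheory.layerLambda θ = Literature.NumberTheory.IwasawaTheory.layerLambda θ' :=
  fun _ _ _ hc h ↦ layerLambda_eq_of_supNorm_sub_C_mul_lt hc h

end Summit.BirchSwinnertonDyer.BirchSwinnertonDyer.Theorems.ThetaLayerLambdaCongruenceAtTwo

end
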